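import Mathlib
import HarnessLib
import HarnessLib.Audit
import Summits.QuantumAdvantage.Statement
import Summits.QuantumAdvantage.AdviceFreeQNC0.AdviceFreeQNC0
import Summits.QuantumAdvantage.AdviceFreeQNC0.RingHardOdd
import Summits.QuantumAdvantage.AdviceFreeQNC0.AdviceFreeQNC0Three
import Summits.QuantumAdvantage.AdviceFreeQNC0.AffBells22FrameJunta
import Summits.QuantumAdvantage.AdviceFreeQNC0.AffBells37PolyLoss
import Summits.QuantumAdvantage.QuantumAdvantage.Theorems.RingFrameBridge
import Literature.Computability.MetaComplexity.SmolenskyProperty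
import Summits.QuantumAdvantage.QuantumAdvantage.Theorems.MultiRingBridge
import Summits.QuantumAdvantage.QuantumAdvantage.Theorems.ExactnessDialOddToAll
import Summits.QuantumAdvantage.QuantumAdvantage.Theorems.StakeDialE
import HarnessLib.Audit.Status.Attr

/-!
Route: SupportDial

# Route SupportDial — The fan-in dial on the 𝔽₃ ring game — zone-free hub certificates and the
proved even-stretch collapse reduce 27380 to a half-degree 𝔽₂ law on the bare cycle plus a declared
majority lift (F-Q1-p3)

DECOMPOSITION CELL decomp-qadv (D-0178/D-0179), RESIDUAL MODE on T = stmt-QuantumAdvantage-27380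
`NoPerfectConst3` (crux r201 of route-QuantumAdvantage-ExactnessDial, target of
route-QuantumAdvantage-WildDial; second SIBLING route on 27380, ExactnessDial being at the 15-item
cap), node SupportDial (lens decomp-qadv-lens-1 g6 «grading / quantitative ladder», axis = OUTPUT
FAN-IN under arbitrary wiring; file of record decomp-qadv-lens-1/g6/SupportDial.lean v5 sha256
49f72ece5ebd494e (2323 l, farm rc 0, 0 sorry, 0 warnings; v1 2148e268 critic row 39 CLEARED
07:47:14Z, v2 8d187508 39v2, v3 b7abfad3 39v3, v4 5d5d51de 39v5 VERIFIED CLASS HIGH-minus 09:04:09Z;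
tree-ready twin g6/tree/FanInRoot.lean e486fbb3, 1439 l, rc 0, LAND-READY --supports 27380)). It
suffices to show X = P1 ∧ P2 with P1 = `NoPerfectMinority3` (crux r2: for every c, no
constant-degree 𝔽₃ ring strategy ALL of whose outputs read at most (½ − 1/(2c+2))·n inputs is
perfect on the odd class) and P2 = `MinorityLift3` := P1 → T (crux r4, DECLARED RESIDUAL);
`noPerfectConst3_iff_pieces : T ↔ P1 ∧ P2` (node, PROVED). P1 is ATTACKED through the p = 2 law
`HalfDegreeLaw2` (crux r3: perfect play on the odd class of the BARE k-cycle needs 𝔽₂-degree ≥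
(k−1)/2) and the support `HalfToMinority3` := HalfDegreeLaw2 → P1 (= even-stretch collapse PROVED +
hub engine PROVED + the probabilistic selection MinoritySelect3): `closes` consumes HalfDegreeLaw2,
HalfToMinority3, MinorityLift3 and the shared chain below 27380. X is stated here as the attacked
conjunct P1.
Lean: `∀ c : ℕ, ∀ d : ℕ, ∃ n₀ : ℕ, ∀ n ≥ n₀, ∀ P : Fin n →
Literature.Computability.MetaComplexity.Smolensky.CubeFn (ZMod 3) n, (∀ i, P i ∈
Literature.Computability.MetaComplexity.Smolensky.lowDeg (ZMod 3) n d) → (∀ i, ∃ S : Finset (Fin n),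
S.card ≤ c * n / (2 * c + 2) ∧ Summit.QuantumAdvantage.AdviceFreeQNC0.AffBells22.ReadsOnly S (fun x
=> decide (P i x = 1))) → ∃ x : Fin n → Bool, Summit.QuantumAdvantage.AdviceFreeQNC0.OddZeros x ∧ ¬
Literature.Computability.QuantumComplexity.RingHLF.Rel x (fun i => decide (P i x = 1))`

## Assembly
Inside `closes` (glue.lean, 0 sorry): `adviceFreeQNC0Three_iff.mpr
(adviceFreeQNC0Sep_of_hlfNotFAC0Mod 3 (hB (hDP (hO (hM (hC (h2 (hG hD))))))))` — HalfToMinority3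
applied to HalfDegreeLaw2 gives P1, P2 gives T = NoPerfectConst3 (27380); ConstLift3 (27381) gives
T′ = NoPerfectOdd3, MassStep3u (26533) PolyLossOddU3, OddToAll3 (26534) PolyLoss3, DPLift3 (26124)
MultiRingHard3, MultiRingBridge3 (26125, CLOSED) HLFNotFAC0Mod 3, and the tree bridge
`adviceFreeQNC0Sep_of_hlfNotFAC0Mod` + `adviceFreeQNC0Three_iff` the leaf AdviceFreeQNC0Three — the
script of `ExactnessDial.closes` / `WildDial.closes` with their W-binder 27380 discharged by
HalfDegreeLaw2 ∧ HalfToMinority3 ∧ P2.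

CLOSES_TARGET: closes rung F-Q1-p3 of QuantumAdvantage: Summit.QuantumAdvantage.AdviceFreeQNC0.AdviceFreeQNC0Three (D-0061; not the summit Statement) — the deciding theorem of this route concludes that registered leaf instead of the Statement decl `QuantumAdvantage` (class rung: servable and labelled, never counted as concluding the summit Statement).

Rationale: WHY THIS LINE. Bravyi–Gosset–König's classical resource is the LIGHT CONE: their cycle-graph-state
lemma (arXiv:1704.00690 §4.1 Lemma 3, after Barrett–Caves–Eastin–Elliott–Pironio
arXiv:quant-ph/0603032) defeats circuits whose outputs near three even-distance vertices read only
their own geometric zone, and Watts–Kothari–Schaeffer–Tal's locality theorem for Parity Halving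
(arXiv:1906.08890 Thm 10: success ≤ ½ + 2^(−Ω(min(n, n²/ℓ²m))) via pairwise-DISJOINT light cones and
Turán) is void at locality ℓ = Θ(√n) for m = n outputs. The node grades T = 27380 by output FAN-IN
|S_i| ≤ f(n) under ARBITRARY wiring (`AffBells22.ReadsOnly`, tree) and brings a NEW engine past the
disjoint-light-cone ceiling: ZONE-FREE MULTI-HIT HUB CERTIFICATES — background 0, k hubs in
even-stretch position, every output may read ANY r of the k hubs; «perfect on the hub patterns of
the right parity» is an 𝔽₂-LINEAR system in the unknown truth tables, refuted by an annihilating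
functional as soon as k ≥ max(5, 2r+3) (exact linear algebra r ≤ 4; kernel-checked bare-cycle seeds
(5,1),(6,1),(7,2),(8,2),(9,3) and hub seeds n = 15, 21). The lens PROVED the even-stretch collapse
`collapseLaw3` (hub game on H = bare |H|-cycle game) and the comb / quadratic-comb selections
(`Comb.comb_select`, Vandermonde step `Comb2.comb_determined`), making TWO RUNGS of the dial
UNCONDITIONAL THEOREMS — `noPerfectFanInAll_root` (no strategy of ANY form with fan-in ≤ √n/64 is
perfect, n ≥ 4096) and `noPerfectFanInAll_twoThirdsRoot` (fan-in ≤ n^(2/3)/512) — the first results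
above the tree's polylog floor `AffBells34.coverPolylogHard`, by a non-degree method (a √n-junta has
𝔽₃-degree √n ≫ polylog, outside every degree engine in the tree). What remains of P1 is ONE typed p
= 2 exact law, HalfDegreeLaw2 (a Parity-Halving-type statement on the bare cycle, arXiv:1906.08890),
plus Chernoff bookkeeping (MinoritySelect3). Imported areas: quantum nonlocality of graph states
(certificate shape), Razborov–Smolensky annihilators over 𝔽₂ (doi:10.1145/28395.28404), additive
combinatorics of arithmetic combs (selection), probabilistic method.

RANKED CRUXES. #0 NoPerfectConst3 (target) — T = stmt-QuantumAdvantage-27380 (body VERBATIM = tree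
`ExactnessDial.NoPerfectConst3` / `WildDial.NoPerfectConst3`, shared item, staffed on
ExactnessDial/WildDial): for every constant d, for all large n, no 𝔽₃-degree-≤ d ring strategy is
perfect on the odd class. NECESSITY RECORDS (node, PROVED): T → P1
(`noPerfectMinority3_of_noPerfectConst3`, class restriction), T → P2, T ↔ P1 ∧ P2
(`noPerfectConst3_iff_pieces`); kill lane of the node `MinorityPerfectIO3` ↔ ¬P1
(`minorityPerfectIO3_iff_not`) ⇒ ¬T. (why it might fail: an n-extensible family of perfect quadratic
(or cubic level-steered) strategies for infinitely many n; census thresholds n₁(1) ≥ 7, n₁(2) ≥ 8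
leave room.) [arXiv:1704.00690, doi:10.1109/SFCS.1993.366874, doi:10.1145/28395.28404]
#2 NoPerfectMinority3 (crux) — P1 — MINORITY READERS (NEW; node `NoPerfectMinority3 := ∀ c,
NoPerfectFanIn3 (n ↦ c·n/(2c+2))`, the dial `NoPerfectFanIn3 f` INLINED at f n = c·n/(2c+2);
junction `Iff.rfl`): for every c and every constant d, for all large n, no ring strategy whose
outputs are 𝔽₃-degree-≤ d events EACH READING A SET OF AT MOST (½ − 1/(2c+2))·n INPUTS
(`AffBells22.ReadsOnly`, arbitrary wiring) is perfect on the odd class. TAGS: NECESSARY (restriction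
of T) · WEAKER (class restriction; converse = P2) · OPEN · ATTACKABLE NOW: P1 ⟸ HalfDegreeLaw2 ∧
MinoritySelect3 (`noPerfectMinority3_of_halfDegree_select`, PROVED: `collapseLaw3` + `dep_on_hubs` +
`noPerfectFanInAll_minority_of_engine`), filed as crux HalfDegreeLaw2 + support HalfToMinority3
(binders of `closes`; P1 is in the cone as their conclusion and stays directly claimable) ·
INSTRUMENTABLE (certificate table (k, r): INCONSISTENT for
(5,0),(5,1),(6,1),(7..12,1),(7,2),(8,2),(9,2),(10,2),(9,3),(10,3),(11,3),(11,4), CONSISTENT for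
(3,0),(4,0),(4,1),(6,2),(8,3),(10,4): threshold max(5, 2r+3), codimension 1 at k = 2r+3; census
K10a/K10b/K10a′/K10b′ of NODE-g6.md; `hubLoses_one/_two/_three` are THEOREMS: census K10c settled at
r ≤ 3). THE DIAL BELOW P1, ALL PROVED (node v4/v5, axioms standard): R0 polylog
(`noPerfectFanInPolylog3`, tree floor), R1′ √n/64 (`noPerfectFanInRoot3`, from the DEGREE-FREE
`noPerfectFanInAll_root`), R⅔′ n^(2/3)/512 (`noPerfectFanInTwoThirdsRoot3`); P1 → R2 (n/4) → R⅔ → R1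
PROVED monotonicity. KILL LANE = a refutation of this item (`MinorityPerfectIO3 ↔ ¬P1`), which
refutes T as well. [difficulty: open-problem] (why it might fail: rests on the p = 2 law
HalfDegreeLaw2 (data k ≤ 12, seeds r ≤ 3): if the annihilator family stops at some r₀ the fan-in
fractions in (r₀/(2r₀+3), ½) are as hard as T; an n-extensible PERFECT constant-degree
minority-reader family refutes P1 and T together.) [arXiv:1704.00690, arXiv:quant-ph/0603032,
arXiv:1906.08890, doi:10.1145/28395.28404]
#3 HalfDegreeLaw2 (crux) — THE LOAD-BEARING p = 2 LAW (NEW; node `HalfDegreeLaw2 := ∀ k r, 2r+3 ≤ k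
→ SmallRingLosesDeg k r`, `SmallRingLosesDeg` INLINED; junction `Iff.rfl`; critic row 39v3: «the
best ATTACKABLE / INSTRUMENTABLE new text on the fan-in line, crux r3, load-bearing for P1»): on the
BARE k-cycle, every strategy all of whose output coordinates are 𝔽₂-polynomials of degree ≤ r in the
input loses some odd-class input as soon as k ≥ 2r+3 — perfect play on the odd class of C_k needs
𝔽₂-degree ≥ (k−1)/2. STATUS: data k ≤ 12 in both directions (degree (k−1)/2 − 1 always loses; the
bound is attained, codimension exactly 1 at k = 2r+3, r ≤ 4); kernel-checked seeds
`smallRingLosesDeg_5_1`, `_6_1`, `_7_2`, `_8_2`, `_9_3` (explicit annihilators, node §6b;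
(5,1)…(8,2) in the twin FanInRoot); the log-degree range ∀ r ∃ K ∀ k ≥ K PROVED from the tree mass
theorem `ringHardOdd_two` (`smallRingLosesDeg_of_large`); k ↦ k+2 monotonicity follows from the
PROVED collapse (two adjacent non-hubs form an even stretch). USE (PROVED): HalfDegreeLaw2 ⟹
HubCertificateLaw3 (`hubCertificateLaw3_of_halfDegree`) ⟹ with MinoritySelect3, P1; degree-r combs +
seeds (2r+3, r), (2r+4, r) ⟹ unconditional fan-in rungs n^(r/(r+1))/C_r (r = 1, 2 done; r = 3 needs
only the even seed (10, 3)). TAGS: W · OPEN · ATTACKABLE (uniform annihilator family; BC3 skeleton =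
threshold pair + two-step) · INSTRUMENTABLE (census K10b′: (13,5), (15,6)). [difficulty:
open-problem] (why it might fail: the 𝔽₂-linear certificate system may become CONSISTENT at some
(2r+3, r), r ≥ 5 (codimension is exactly 1 at every tested threshold k = 2r+3, r ≤ 4 — one lost
equation flips it); the tree's p = 2 engine ringHardOdd_two stops at degree polylog k.)
[arXiv:1906.08890, arXiv:1704.00690, doi:10.1145/28395.28404]
#4 MinorityLift3 (crux) — P2 — DECLARED RESIDUAL (NEW; ≡ T mod P1): minority ⟹ all —
NoPerfectMinority3 → NoPerfectConst3. The complement class has a MAJORITY READER (some output reads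
more than (½ − 1/(2c+2))·n inputs for every c); there the hub engine is blind (certificate systems
CONSISTENT at (2r+2, r): an output reading r+1 of 2r+2 hubs can play perfectly on hub-supported
inputs — the GHZ «see enough inputs» trivialisation) and the tree's exact tools (window-local walks,
frame juntas) do not reach. IDEA-NEEDED; no plan is claimed; vacuously necessary
(`minorityLift3_of_noPerfectConst3`). BC3 budget-lift skeleton on file (minority → co-linear readers
→ all) only LOCALISES where the idea is needed. [deps: NoPerfectMinority3, NoPerfectConst3]
[difficulty: open-problem] (why it might fail: T may fail exactly in the majority-reader class (a
perfect constant-degree family whose outputs each read > n/2 inputs) while P1 holds: hub systems are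
CONSISTENT at (2r+2, r), the tree's exact tools are window-local, no idea is recorded.)
[arXiv:1704.00690, arXiv:quant-ph/0603032, doi:10.1109/SFCS.1993.366874]
#5 ConstLift3 (crux) — ExactnessDial's declared residual stmt-QuantumAdvantage-27381 (body VERBATIM,
shared; also WildDial crux r4): NoPerfectConst3 → NoPerfectOdd3 — from «d₃* → ∞» to «d₃*
super-polylogarithmic». Untouched by this node. [deps: NoPerfectConst3, NoPerfectOdd3] [difficulty:
open-problem] (why it might fail: d₃*(n) may grow only logarithmically (perfect strategies of degree
C·log₂ n for infinitely many n), so NoPerfectConst3 holds and T′ fails.)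
[doi:10.1109/SFCS.1993.366874, arXiv:1906.08890, kit:j337947]
#6 MassStep3u (crux) — ExactnessDial's declared residual stmt-QuantumAdvantage-26533 (body VERBATIM,
shared; also WildDial crux r5): NoPerfectOdd3 → PolyLossOddU3 — from no perfect polylog-degree
strategy to inverse-polynomial loss on the odd class. Untouched by this node. [deps: NoPerfectOdd3,
PolyLossOddU3] [difficulty: open-problem] (why it might fail: a polylog-degree family that is
imperfect but loses only an n^(−ω(1)) fraction of the odd class; no mass-transfer mechanism from
affine fibres to polylog degree is known.) [arXiv:1704.00690, doi:10.4086/toc.2008.v004a007,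
BarringtonStraubingTherien1990]
#7 DPLift3 (crux) — ProductDial's residual stmt-QuantumAdvantage-26124 (body VERBATIM, shared; also
WildDial crux r6): PolyLoss3 → MultiRingHard3 — the direct-product lift from single-ring
inverse-polynomial loss to many-ring hardness. Untouched by this node. [deps: PolyLoss3,
MultiRingHard3] [difficulty: open-problem] (why it might fail: no direct-product theorem for
polylog-degree 𝔽₃ joint strategies against a search relation is in print (Viola–Wigderson stops at
degree ≪ log n and at functions).) [doi:10.4086/toc.2008.v004a007, arXiv:1704.00690, goldreich2004]
#9 HalfToMinority3 (support) — the engine glue HalfDegreeLaw2 → NoPerfectMinority3 (NEW support;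
PROVED in the node MODULO the selection `MinoritySelect3`: `noPerfectMinority3_of_halfDegree_select
hD hSel`, i.e. HalfToMinority3 ⟸ MinoritySelect3 alone — junction example). Content left:
MinoritySelect3 (against n reading sets of size ≤ c·n/(2c+2) there is an even-stretch hub set H, |H|
≥ 5, met by every set in at most (|H|−3)/2 hubs — random alternating-parity positions, |H| = Θ(log
n), Chernoff with margin 1/(2c+2)) + the landed collapse/engine (twin FanInRoot `collapseLaw3`, then
a ≤ 100-line closer re-deriving the engine step `noPerfectFanInAll_minority_of_engine` /
`dep_on_hubs`). Why it might fail (support-grade): only the Chernoff bookkeeping — the hub count |H|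
= Θ(log n) must beat n union-bound events at constant margin. [deps: HalfDegreeLaw2,
NoPerfectMinority3] [difficulty: provable-now] [arXiv:1704.00690, arXiv:quant-ph/0603032]
#9 OddToAll3 (support) — stmt-QuantumAdvantage-26534 (body VERBATIM, shared): PolyLossOddU3 →
PolyLoss3 (odd-class loss to all-class loss; PROVED in the lens files of ExactnessDial, landing
pending). [difficulty: provable-now] [arXiv:1704.00690, BarringtonStraubingTherien1990]
#9 MultiRingBridge3 (support) — stmt-QuantumAdvantage-26125 (body VERBATIM, shared): MultiRingHard3
→ HLFNotFAC0Mod 3 — CLOSED proved 09:00:05Z (census landing p767120/p767159/p767285, tree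
`Theorems.exactnessDial_multiRingBridge3`; junction example discharges this binder by name).
[difficulty: provable-now] [arXiv:1704.00690, doi:10.1145/28395.28404]
#9 NoPerfectOdd3 (support) — record — stmt-QuantumAdvantage-26532 (body VERBATIM, shared;
ExactnessDial's split parent T′): no perfect polylog-degree 𝔽₃ ring strategy on the odd class;
needed BY NAME by ConstLift3 / MassStep3u. [difficulty: open-problem] [arXiv:1704.00690,
doi:10.1145/28395.28404]
#9 PolyLossOddU3 (support) — record — stmt-QuantumAdvantage-26531 (body VERBATIM, shared;
ExactnessDial target): c-uniform inverse-polynomial loss on the odd class; needed BY NAME by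
MassStep3u / OddToAll3. [difficulty: open-problem] [arXiv:1704.00690,
BarringtonStraubingTherien1990]
#9 PolyLoss3 (support) — record — stmt-QuantumAdvantage-26123 (body VERBATIM, shared; ProductDial):
inverse-polynomial loss of every polylog-degree 𝔽₃ ring strategy; needed BY NAME by OddToAll3 /
DPLift3. [difficulty: open-problem] [arXiv:1704.00690, doi:10.1145/28395.28404]
#9 MultiRingHard3 (support) — record — stmt-QuantumAdvantage-26122 (body VERBATIM, shared;
ProductDial): many-ring hardness ∃ K ∃ θ < 1 ∀ c; needed BY NAME by DPLift3 / MultiRingBridge3.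
[difficulty: open-problem] [arXiv:1704.00690, doi:10.4086/toc.2008.v004a007]

TWO-LAYER PLAN. HalfDegreeLaw2 ⇐ stub_thresholdOdd (∀ r, SmallRingLosesDeg (2r+3) r — the
codimension-1 heart) + stub_thresholdEven (∀ r, SmallRingLosesDeg (2r+4) r) + stub_stepTwo (∀ k r,
SmallRingLosesDeg k r → SmallRingLosesDeg (k+2) r — provable-now from the PROVED collapse with n =
k+2 and one even stretch of two non-hubs), composition `HalfDegreeLaw2_of` by two-step induction on
k − (2r+3) (BC3 skeleton HalfDegreeLaw2_birth.lean, sorries = stubs = 3). NoPerfectMinority3 ⇐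
stub_hubCertificateLaw3 (⟸ HalfDegreeLaw2, PROVED) + stub_minoritySelect3 (the node's
`MinoritySelect3`), composition `NoPerfectMinority3_of` = the node's PROVED engine glue
(NoPerfectMinority3_birth.lean, sorries = stubs = 2). MinorityLift3 ⇐ stub_coLinearLift (minority
readers ⟹ readers ignoring a constant FRACTION of the inputs) + stub_totalLift (those ⟹ all) — a
budget-lift split that only localises the missing idea (engine-blind from the first stub on).

KILL CRITERIA. A refutation of NoPerfectMinority3 (kill lane MinorityPerfectIO3: some c, d and, for
infinitely many n, a PERFECT 𝔽₃-degree-≤ d ring strategy all of whose outputs read ≤ c·n/(2c+2)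
inputs) closes this route AND refutes T = 27380 (hence ExactnessDial's crux r201 and WildDial's
target). A refutation of HalfDegreeLaw2 at one (k, r) with k ≥ 2r+3 (a perfect 𝔽₂-degree-r strategy
on the bare k-cycle's odd class; cheapest candidates (13,5), (15,6)) BREAKS the route as typed
(class misstated: the repaired crux is the law with a larger threshold g(r), and P1 survives for
fractions below r/g(r)); a consistent system at EVERY threshold beyond some r₀ kills the engine
above fraction r₀/(2r₀+3) (substantive for P1 as typed). A proof of ¬MinorityLift3 (T false with P1
true) retires the line as drawn (residual substantive).

NOT DECOMPOSED YET. MinorityLift3 stays whole (declared residual; IDEA-NEEDED). Not filed as items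
(cap 15, named-rung rule): the PROVED rungs R0 `NoPerfectFanInPolylog3`, R1′ `NoPerfectFanInRoot3`
(√n/64), R⅔′ `NoPerfectFanInTwoThirdsRoot3` (n^(2/3)/512) and the degree-free
`noPerfectFanInAll_root` / `_twoThirdsRoot` — they land as
Summits/QuantumAdvantage/QuantumAdvantage/Theorems/FanInRoot.lean (twin e486fbb3, 1439 l,
`--supports stmt-QuantumAdvantage-27380` and this route's P1 / HalfDegreeLaw2 items; includes
`collapseLaw3`, `hubLoses_one/_two`, `hubLaw_large`, seeds (5,1)…(8,2)); R2 `NoPerfectQuarter3`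
(n/4); the engine's typed laws `HubCertificateLaw3` / `HubCertificateOne3` (⟸ HalfDegreeLaw2,
PROVED); the selection `MinoritySelect3` (inside HalfToMinority3; a registered stub of P1's
skeleton); the kill lane `MinorityPerfectIO3` (= ¬P1). The r = 3 rung n^(3/4)/C needs only the even
seed (10, 3).

CHEAPEST FALSIFIER. In-Lean / exact linear algebra, seconds to minutes: is the 𝔽₂-linear certificate
system «perfect on the 2^(k−1) odd-class inputs of the bare k-cycle, every output of 𝔽₂-degree ≤ r»
CONSISTENT at (k, r) = (13, 5) or (15, 6)? (node exp/scan*.py; unknowns Σ_(i≤r) C(k,i) per output;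
CONSISTENT ⇒ HalfDegreeLaw2 is FALSE as typed at that r and the engine caps at fan-in fraction
r/(2r+3); the node reports INCONSISTENT through (11, 4), codimension 1 at each threshold) — census
handle K10b′.

NUMBERS. Certificate table (node data, exact linear algebra over 𝔽₂): INCONSISTENT (the hubs win)
for (k, r) ∈ {(5,0),(5,1),(6,1),(7..12,1),(7,2),(8,2),(9,2),(10,2),(9,3),(10,3),(11,3),(11,4)} and
for 50/50 random even stretch vectors at (5,1),(6,1),(7,2),(8,2),(9,3); CONSISTENT for
(3,0),(4,0),(4,1),(6,2),(8,3),(10,4) and for most mixed-parity stretch vectors; threshold g(r) =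
max(5, 2r+3), codimension exactly 1 at k = 2r+3 (r = 1..4). Kernel-checked (axioms
propext/Classical.choice/Quot.sound): `hubLoses_seed15` (n = 15, H = {0,3,6,9,12}, r = 1),
`hubLoses_seed21` (n = 21, r = 2, |Λ| = 43), `smallRingLosesDeg_5_1/_6_1/_7_2/_8_2/_9_3`,
`collapseLaw3`, table laws `hubLoses_one` (|H| ∈ {5,6}, r = 1), `hubLoses_two` ({7,8}, 2),
`hubLoses_three` (9, 3), `hubLaw_large` (∀ r ∃ K); comb selection: non-wrapping arithmetic combs t +
a·g (g odd, k ∈ {5,6}, k ≡ n mod 2) are even-stretch and #bad ≤ 36·n·f² < (n/2)(n/20) ≤ #combs for f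
≤ √n/64, n ≥ 4096 (`Comb.comb_select`); quadratic combs t + a·g + a²·h (g+h odd): three teeth
determine the comb (Vandermonde), #bad ≤ 512·n·f³ < #family for f ≤ n^(2/3)/512
(`Comb2.comb_select`) ⇒ UNCONDITIONAL rungs √n/64 and n^(2/3)/512 (`noPerfectFanInAll_root`,
`noPerfectFanInAll_twoThirdsRoot`, n ≥ 4096). Fan-in fractions reached given HalfDegreeLaw2 up to r:
r/(2r+3) → ½; unconditional exponents r/(r+1) given the seeds (2r+3, r), (2r+4, r).

DEFINITION REQUESTS. None: every item is stated in EVALUATED form over tree constants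
(`Smolensky.CubeFn/lowDeg`, `RingHLF.Rel`, `AdviceFreeQNC0.OddZeros`, `AffBells22.ReadsOnly`,
`HLFNotFAC0Mod`, `finProdFinEquiv`); the node's graded defs (`NoPerfectFanIn3 f`,
`SmallRingLosesDeg`, `EvenStretch`, `HubSupported`, `HubLoses`) are inlined where an item needs them
and land with the twin FanInRoot.

Novelty: Searches (2026-08-30, writer g4): corpus `lit search --hybrid "light cone bounded fan-in classical
circuit hidden linear function lower bound"` (8 docs: [corpus:paper:arxiv-1704.00690-gx05872880 pp
3,6,11,13–16] BGK Theorem 2 / Definition 2 (light cone) / §4.1 Lemma 3; Arora–Barak, Jukna generic);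
`lit search "parity halving" --source local` ([corpus:paper:arxiv-1906.08890 p.8,10,11,16]: WKST
Parity Halving, Thm 10 locality-ℓ NC⁰ circuits solve PHP_(n,m) w.p. ≤ ½ + 2^(−Ω(min(n, n²/ℓ²m))) by
pairwise-disjoint light cones + Turán, «essentially tight», void at ℓ = Θ(√n) for m = n); `lit
search --hybrid "parity halving problem bare cycle F2 polynomial degree lower bound exact relation"`
(8 docs: Jukna 2012 pp 83,92,356–364 approximation-degree background, Kaye–Laflamme–Mosca p 176,
Bürgisser–Clausen–Shokrollahi — no exact relation-degree law); `lit vsearch "<HalfDegreeLaw2 in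
prose>"` (8 docs: Jukna 2012/2011, Carlet 2020, Mesnager 2016 — annihilator / algebraic-immunity
background only); galaxy `lit galaxy search "Parity Halving|parity halving problem" --star all` (2
pdf hits: [galaxy:pdf:-2756880049553291600] Grewal–Kumar ECCC TR24-130 pp 12–13 — state of the art
of quantum/classical shallow-circuit separations: QNC⁰ vs exponential-size AC⁰ (WKST19), QNC⁰/qpoly
vs AC⁰[p] (WKST19, GKMdO24), QNC⁰ vs GC⁰(k)[p]; the advice-free QNC⁰ vs AC⁰[p] relation bound (our
leaf family) is not among them; [galaxy:pdf:5180146640] Neumann thesis 2025, generic), earlier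
`"parity halving|graph sta  [refs: 1704.00690, quant-ph/0603032, 1906.08890, paper:arxiv-1704.00690-gx05872880, paper:arxiv-1906.08890]

Barriers (technique_class: polynomial-method, junta certificate, F2-annihilator): - technique_class: polynomial-method, junta certificate, F2-annihilator
- Literature.Barriers.QuantumAdvantage.TwoModuliDepthTwo: P1 and HalfDegreeLaw2 sit OUTSIDE — the
certificate never composes the mod-3 degree with the mod-2 ring relation: it restricts to
hub-supported inputs where each output is an r-junta of the hub bits (pure 𝔽₂ statement, degree-free
form `NoPerfectFanInAll` PROVED at √n/64 and n^(2/3)/512), and HalfDegreeLaw2 is a single-modulus (p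
= 2) statement; P2 (declared residual) is where a majority reader forces the 𝔽₃-degree hypothesis
back in — INSIDE, no evasion claimed (residual).
- Literature.Barriers.QuantumAdvantage.NonclassicalDegreeLogBarrier: the tree's 𝔽₂-degree engines
(`ringHardOdd_two`, `coverPolylogHard`) stop at light cones / degree polylog because a f(n)-junta
has 𝔽₂-degree f(n) and CORRELATION bounds die beyond degree log (Bhowmick–Lovett); the hub
certificate bounds the number r of HUBS read, not degree in n, and HalfDegreeLaw2 at LINEAR degree
(k−1)/2 is an EXACT perfect-play statement — the negation of feasibility of a finite 𝔽₂-linear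
system, decided at each (k, r) by an explicit annihilator — not a correlation bound, so the
barrier's quantifier (approximate computation by low-degree polynomials) does not cover it; honest
caveat: no tree method proves exact unsolvability above degree polylog either — the bet is the
codimension-1 structure at k = 2r+3 (a uniform annihilator family); the barrier bites again only in
P2.
- Literature.Barrier

History (route lifecycle, newest last):
- 2026-08-30T11:59:44Z · rev 5: informal re-worded for HalfDegreeLaw2 (planner-decomp-qadv-writer-1-g5-0)
- 2026-08-30T12:00:26Z · rev 6: restated Assembly (stmt-QuantumAdvantage-31931) — writer g5: restate Assembly after the drops of HalfToMinority3 / MultiRingBridge3 (its rev-0 text referenced them; gate rendered it BLOCKED) — now literally the (planner-decomp-qadv-writer-1-g5-0)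
- 2026-08-30T12:00:58Z · rev 6: restated Assembly (stmt-QuantumAdvantage-31931) — writer g5: restate Assembly after the drops of HalfToMinority3 / MultiRingBridge3 (its rev-0 text referenced them; gate rendered it BLOCKED) — now literally the (planner-decomp-qadv-writer-1-g5-0)
- 2026-08-30T12:01:28Z · rev 6: restated Assembly (stmt-QuantumAdvantage-31931) — writer g5: restate Assembly after the drops of HalfToMinority3 / MultiRingBridge3 (its rev-0 text referenced them; gate rendered it BLOCKED) — now literally the (planner-decomp-qadv-writer-1-g5-0)
- 2026-08-30T12:01:59Z · rev 6: restated Assembly (stmt-QuantumAdvantage-31931) — writer g5: restate Assembly after the drops of HalfToMinority3 / MultiRingBridge3 (its rev-0 text referenced them; gate rendered it BLOCKED) — now literally the (planner-decomp-qadv-writer-1-g5-0)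
- 2026-08-30T12:32:23Z · rev 8: informal re-worded for SignTwistLaw2, SignTwistLift2, HalfDegreeLaw2, NoPerfectMinority3 (planner-decomp-qadv-writer-1-g5-0)
- 2026-08-30T19:19:44Z · rev 9: informal re-worded for MinorityLift3 (planner-decomp-qadv-writer-1-g6-0)
- 2026-08-30T21:43:29Z · RESIDUAL declared: MinorityLift3 (stmt-QuantumAdvantage-31929) — summit-strength until shown otherwise: writer g7 schema sync (D-0170): residual flag = the route's DECLARED RESIDUAL exactly as its critic-cleared node/docstri (planner-decomp-qadv-writer-1-g7-0)

sub-problem: QuantumAdvantage · status: draft · opened planner-decomp-qadv-writer-1-g4-0 2026-08-30T09:57:13Z · rev 9 · ledger route-QuantumAdvantage-SupportDial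
GENERATED by the gate from the ledger (D-0016/17). Provers cite these decls: `theorem foo : Summit.QuantumAdvantage.QuantumAdvantage.Theses.SupportDial.<Decl> := …` in Summits/QuantumAdvantage/QuantumAdvantage/Theorems/<Name>.lean.
-/

namespace Summit.QuantumAdvantage.QuantumAdvantage.Theses.SupportDial

open scoped BigOperators Topology Manifold Classical MeasureTheory ProbabilityTheory Matrix InnerProductSpace ComplexConjugate ContinuousMap
open Filter Set Function TopologicalSpace MeasureTheory

attribute [summit_statement] _root_.QuantumAdvantage
attribute [summit_statement] _root_.Summit.QuantumAdvantage.AdviceFreeQNC0.AdviceFreeQNC0Three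

open Literature.QuantumAdvantage

/-- item stmt-QuantumAdvantage-27380 · target · rank 0 · open · by planner
why it might fail: an n-extensible family of perfect quadratic (or cubic level-steered) strategies for infinitely many n; census thresholds n₁(1) ≥ 7, n₁(2) ≥ 8 leave room.
sources: arXiv:1704.00690, doi:10.1109/SFCS.1993.366874, doi:10.1145/28395.28404
[crux] PIECE 1 of the glued split of NoPerfectOdd3 (stmt-QuantumAdvantage-26532; lens-1 g3 node
DegreeGrowthDial sha256 bb8a8a2b…, critic row 18 CLEARED 2026-08-30T03:52:24Z) — the GROWTH grade
«d₃*(n) → ∞»: for every constant d, for all large n, no strategy with outputs of 𝔽₃-degree ≤ d is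
perfect on the odd class of the n-cycle. NECESSARY (T′ = NoPerfectOdd3 → it and T = RingHardOdd 3 →
it PROVED in the node); WEAKER-GENUINE (fixed d vs (log₂ n)^c); INSTRUMENTABLE cell-by-cell
(PerfectAt n d decidable; kernel certificates d₃*(5) = d₃*(6) = d₃*(7) = 1 and d₃*(8) ≤ 2,
perfectAt_eight_two = census (A) E2's shift-covariant quadratic rule); rung d = 1 is the THEOREM
NoPerfectAffine3 = stmt-26535 (BC5 witness, noPerfectAffine3 PROVED in the node); FIRST OPEN RUNG d
= 2 = aside NoPerfectTwo3. [deps: none] [difficulty: L] SPARSE-ACTIVE DIAL RECORD 2026-08-30 (lens-2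
g8 node SparseDial rev 1 sha256 3f1a9b0e… 1088 l, rc0 · 0 sorry, axioms std; critic row 42 CLEARED
08:22:44Z as a LAW / SUPPORT node, NOT a split — NoPerfect d ↔ DenseLose d K is PROVED for every K,
↔ NetLose d; no DenseLose/NetLose item): AXIS = number of ACTIVE outputs (outputs deviating on the
odd class from the canonical -/
@[route_item "route-QuantumAdvantage-SupportDial"]
def NoPerfectConst3 : Prop :=
  ∀ d : ℕ, ∃ n₀ : ℕ, ∀ n ≥ n₀, ∀ P : Fin n → Literature.Computability.MetaComplexity.Smolensky.CubeFn (ZMod 3) n, (∀ i, P i ∈ Literature.Computability.MetaComplexity.Smolensky.lowDeg (ZMod 3) n d) → ∃ x : Fin n → Bool, Summit.QuantumAdvantage.AdviceFreeQNC0.OddZeros x ∧ ¬ Literature.Computability.QuantumComplexity.RingHLF.Rel x (fun i => decide (P i x = 1))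

/-- item stmt-QuantumAdvantage-31926 · crux · rank 2 · closed · proved by Summit.QuantumAdvantage.QuantumAdvantage.Theorems.SupportDialMinority.noPerfectMinority3_holds (prover) · by planner
why it might fail: rests on the p = 2 law HalfDegreeLaw2 (data k ≤ 12, seeds r ≤ 3): if the annihilator family stops at some r₀ the fan-in fractions in (r₀/(2r₀+3), ½) are as hard as T; an n-extensible PERFECT constant-degree minority-reader family refutes P1 and T together.
sources: arXiv:1704.00690, arXiv:quant-ph/0603032, arXiv:1906.08890, doi:10.1145/28395.28404
[crux] P1 — MINORITY READERS (NEW; node `NoPerfectMinority3 := ∀ c, NoPerfectFanIn3 (n ↦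
c·n/(2c+2))`, the dial `NoPerfectFanIn3 f` INLINED at f n = c·n/(2c+2); junction `Iff.rfl`): for
every c and every constant d, for all large n, no ring strategy whose outputs are 𝔽₃-degree-≤ d
events EACH READING A SET OF AT MOST (½ − 1/(2c+2))·n INPUTS (`AffBells22.ReadsOnly`, arbitrary
wiring) is perfect on the odd class. TAGS: NECESSARY (restriction of T) · WEAKER (class restriction;
converse = P2) · OPEN · ATTACKABLE NOW: P1 ⟸ HalfDegreeLaw2 ∧ MinoritySelect3
(`noPerfectMinority3_of_halfDegree_select`, PROVED: `collapseLaw3` + `dep_on_hubs` +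
`noPerfectFanInAll_minority_of_engine`), filed as crux HalfDegreeLaw2 + support HalfToMinority3
(binders of `closes`; P1 is in the cone as their conclusion and stays directly claimable) ·
INSTRUMENTABLE (certificate table (k, r): INCONSISTENT for
(5,0),(5,1),(6,1),(7..12,1),(7,2),(8,2),(9,2),(10,2),(9,3),(10,3),(11,3),(11,4), CONSISTENT for
(3,0),(4,0),(4,1),(6,2),(8,3),(10,4): threshold max(5, 2r+3), codimension 1 at k = 2r+3; census
K10a/K10b/K10a′/K10b′ of NODE-g6.md; `hubLoses_one/_two/_three` are THEOREMS: census K10c settled at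
r ≤ 3). THE DIAL B -/
@[route_item "route-QuantumAdvantage-SupportDial"]
def NoPerfectMinority3 : Prop :=
  ∀ c : ℕ, ∀ d : ℕ, ∃ n₀ : ℕ, ∀ n ≥ n₀, ∀ P : Fin n → Literature.Computability.MetaComplexity.Smolensky.CubeFn (ZMod 3) n, (∀ i, P i ∈ Literature.Computability.MetaComplexity.Smolensky.lowDeg (ZMod 3) n d) → (∀ i, ∃ S : Finset (Fin n), S.card ≤ c * n / (2 * c + 2) ∧ Summit.QuantumAdvantage.AdviceFreeQNC0.AffBells22.ReadsOnly S (fun x => decide (P i x = 1))) → ∃ x : Fin n → Bool, Summit.QuantumAdvantage.AdviceFreeQNC0.OddZeros x ∧ ¬ Literature.Computability.QuantumComplexity.RingHLF.Rel x (fun i => decide (P i x = 1))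

-- `NoPerfectMinority3` holds: proved by `Summit.QuantumAdvantage.QuantumAdvantage.Theorems.SupportDialMinority.noPerfectMinority3_holds` (its module imports this route file, so no `_holds` link can be stated here).

-- earlier HalfDegreeLaw2 (stmt-QuantumAdvantage-31927, replaced 2026-08-30T10:25:06Z -> stmt-QuantumAdvantage-32140): retired by None — ∀ k r : ℕ, 2 * r + 3 ≤ k → ∀ w : (Fin k → Bool) → Fin k → Bool, (∀ j : Fin k, (fun β : Fin k → Bool => if w β j = true then (1 : ZMod 2) else 0) ∈ Literature.Computability.MetaComplexity.Smolensky.lowDeg (ZMod 2) k r) → ∃ β : Fin k → Bool, Summit.QuantumAdvantage.Ad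
/-- item stmt-QuantumAdvantage-32140 · crux · rank 3 · closed · proved by Summit.QuantumAdvantage.QuantumAdvantage.Theorems.SupportDialResidueCertificate.halfDegreeLaw2_holds (prover) · by planner
why it might fail: If N_{2r+3} is EVEN for some r ≥ 3 (kernel-decided only r ≤ 2; DP odd to r = 399) the rotation-number certificate dies at that grade and the law needs another annihilator there; the GF(2) table covers k ≤ 13 only, and no general method proves exact unsolvability above degree polylog.
sources: arXiv:1906.08890, arXiv:1704.00690, doi:10.1145/28395.28404, decomp-qadv lens-1 g7 ResidueDial.lean d3152e1a
[crux] THE LOAD-BEARING p = 2 LAW (rev-1 text, binder 5 ≤ k; the rev-0 text «∀ k r, 2r+3 ≤ k → …»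
was REFUTED as typed at (k,r) = (3,0),(4,0) by the constant all-ones strategy — lens-1 g7
RefuteHalfDegree.lean 1846efc7 `Scratch.not_halfDegreeLaw2`, class misstated, negative edge = item
31927). STATEMENT: on the bare k-cycle, k ≥ 5, every strategy all of whose outputs are
𝔽₂-polynomials of degree ≤ r in the input loses some odd-class input once k ≥ 2r+3 (perfect
odd-class play on C_k needs 𝔽₂-degree ≥ (k−1)/2). RESIDUE RECORD rev 4 (2026-08-30; lens-1 g7
«ResidueDial» node ResidueDial.lean sha256 d3152e1a…, 1615 l, rc0 · 0 sorry · axioms std; NODE-g7.md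
8e48bb8e; critic rows 51–51v4 VERIFIED HIGH, 0 objections): HalfDegreeLaw2 ⟸ MomentLaw2 ∧
SignTwistLaw2 ∧ YStepLaw2, where MomentLaw2 (closed-form annihilator Λ_r = {β : odd class, rot3 β ≠
0}, rot3 = ℤ/3 rotation number of the prefix-parity walk — two-block identity `twoBlockLaw2` ⇒
`momentLaw2`) and YStepLaw2 (exact Y-contraction C_k ← C_{k+1}, `yStepLaw2`, r ≥ 1) are THEOREMS ⇒
`halfDegreeLaw2_of_signTwist : SignTwistLaw2 → HalfDegreeLaw2` BY NAME: the open content of this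
crux IS ONE PARITY IDENTITY S = SignTwistLaw2 «N_{2r+3} := -/
@[route_item "route-QuantumAdvantage-SupportDial", crux]
def HalfDegreeLaw2 : Prop :=
  ∀ k r : ℕ, 5 ≤ k → 2 * r + 3 ≤ k → ∀ w : (Fin k → Bool) → Fin k → Bool, (∀ j : Fin k, (fun β : Fin k → Bool => if w β j = true then (1 : ZMod 2) else 0) ∈ Literature.Computability.MetaComplexity.Smolensky.lowDeg (ZMod 2) k r) → ∃ β : Fin k → Bool, Summit.QuantumAdvantage.AdviceFreeQNC0.OddZeros β ∧ ¬ Literature.Computability.QuantumComplexity.RingHLF.Rel β (w β)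

-- `HalfDegreeLaw2` holds: proved by `Summit.QuantumAdvantage.QuantumAdvantage.Theorems.SupportDialResidueCertificate.halfDegreeLaw2_holds` (its module imports this route file, so no `_holds` link can be stated here).

/-- item stmt-QuantumAdvantage-32826 · crux · rank 3 · closed · proved by Summit.QuantumAdvantage.QuantumAdvantage.Theorems.SupportDialResidueCertificate.signTwistLaw2 (prover) · by planner
why it might fail: It DOES fail at k = 3 (N_3 = 0): the parity of N_{2r+3} could flip again at some large r — decided in kernel only for r ≤ 2, by DP for r ≤ 399; the period-2 claim for the 192-state automaton is a script, not yet a theorem.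
sources: arXiv:1704.00690, arXiv:1906.08890, doi:10.1103/PhysRevA.69.062311, decomp-qadv lens-1 g7 NODE-g7.md 8e48bb8e (ResidueDial.lean d3152e1a)
[crux] SIGN-TWIST PARITY LAW S (the open residue of HalfDegreeLaw2 = stmt-QuantumAdvantage-32140,
filed as ONE crux with the by-name glue SignTwistLift2 per critic row 51v4; lens-1 g7 «ResidueDial»
rev 4 node ResidueDial.lean sha256 d3152e1a…, text INLINED over tree decls, junction
`SupportDial.SignTwistLaw2 ↔ ResidueDial.SignTwistLaw2 := Iff.rfl` kernel-checked by the writer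
(sk/JunctionSD3.lean rc0)): for every r ≥ 1, on the threshold ring C_{2r+3}, N_{2r+3} := Σ_β Σ_v [β
∈ Λ ∧ v ∈ K(β)] · signBit β v ≡ 1 (mod 2), where Λ = {β : #zeros(β) odd ∧ rot3 β ≠ 0}, rot3 β = Σ_i
(−1)^{β_0+…+β_i} ∈ ℤ/3 (rotation number of the prefix-parity walk — the NEW object), K(β) =
ker(A_{C_k} + diag β) the ring kernel (tree RingHLF.InKernel) and signBit the BGK sign bit ℓ_β(v)
(tree RingHLF.signBit). WHY IT IS THE CRUX: with the moment law (`momentLaw2`) and the Y-step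
(`yStepLaw2`) PROVED in the node, `halfDegreeLaw2_of_signTwist : S → HalfDegreeLaw2` — S is ALL that
is open of the p = 2 half-degree law, hence (H := univ) of P1 = NoPerfectMinority3. STATUS: grades r
= 1, 2 DECIDED in kernel (`signTwistAt_one/_two`, N_5 = 1, N_7 = 15); N_{2r+3} odd for r ≤ 10 by
literal DP (critic num/signtwist_ext.p -/
@[route_item "route-QuantumAdvantage-SupportDial", crux]
def SignTwistLaw2 : Prop :=
  ∀ r : ℕ, 1 ≤ r → (∑ β : Fin (2 * r + 3) → Bool, ∑ v : Fin (2 * r + 3) → Bool, (if ((decide ((Finset.univ.filter fun b : Fin (2 * r + 3) => β b = false).card % 2 = 1) && decide ((∑ i : Fin (2 * r + 3), (-1 : ZMod 3) ^ (Finset.univ.filter fun j : Fin (2 * r + 3) => j ≤ i ∧ β j = true).card) ≠ 0)) && decide (Literature.Computability.QuantumComplexity.RingHLF.InKernel β v)) = true then (1 : ZMod 2) else 0) * ((Literature.Computability.QuantumComplexity.RingHLF.signBit β v : ℕ) : ZMod 2)) = 1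

-- `SignTwistLaw2` holds: proved by `Summit.QuantumAdvantage.QuantumAdvantage.Theorems.SupportDialResidueCertificate.signTwistLaw2` (its module imports this route file, so no `_holds` link can be stated here).

/-- item stmt-QuantumAdvantage-31929 · crux · RESIDUAL (gen 0; summit-strength until shown otherwise, D-0170) · leaf IDEA-NEEDED · rank 4 · open · by planner
why it might fail: T may fail exactly in the majority-reader class (a perfect constant-degree family whose outputs each read > n/2 inputs) while P1 holds: hub systems are CONSISTENT at (2r+2, r), the tree's exact tools are window-local, no idea is recorded.
sources: arXiv:1704.00690, arXiv:quant-ph/0603032, doi:10.1109/SFCS.1993.366874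
[crux] P2 — DECLARED RESIDUAL (NEW; ≡ T mod P1): minority ⟹ all — NoPerfectMinority3 →
NoPerfectConst3. The complement class has a MAJORITY READER (some output reads more than (½ −
1/(2c+2))·n inputs for every c); there the hub engine is blind (certificate systems CONSISTENT at
(2r+2, r): an output reading r+1 of 2r+2 hubs can play perfectly on hub-supported inputs — the GHZ
«see enough inputs» trivialisation) and the tree's exact tools (window-local walks, frame juntas) do
not reach. IDEA-NEEDED; no plan is claimed; vacuously necessary
(`minorityLift3_of_noPerfectConst3`). BC3 budget-lift skeleton on file (minority → co-linear readers
→ all) only LOCALISES where the idea is needed. [deps: NoPerfectMinority3, NoPerfectConst3]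
[difficulty: open-problem] ‖ STAKE DIAL RECORD (lens-1 g9 «StakeDial» rev 6 eff22b10, critic rows
72–72v3; writer g6 2026-08-30): the consequent T = 27380 ⟺ StakeDial.CoveringDense3 (R′: for every
d, for all large n, every degree-d strategy ALL of whose silent complements M are DENSE, n <
|M|(4d+2)+3, and COVERING, no exposed dead point — no walk point with every M-stake dead and sign
S_n = +1 — loses on some odd-class input) by the node theorem `coveringDense -/
@[route_item "route-QuantumAdvantage-SupportDial", crux (bottleneck := idea) (source := "ledger wanted_by.residual on stmt-QuantumAdvantage-31929, 2026-09-01")]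
def MinorityLift3 : Prop :=
  NoPerfectMinority3 → NoPerfectConst3

/-- item stmt-QuantumAdvantage-26122 · support · rank 9 · open · by planner
sources: arXiv:1704.00690, doi:10.4086/toc.2008.v004a007
[target] T* (the reformulated target, rank 0; assembly conclusion of layer 2): there are K and θ < 1
such that for every c, for all large n, every joint strategy for n^K rings of length n whose outputs
are 𝔽₃-polynomials of degree ≤ (log₂ n)^c in all n^K·n input bits wins all rings (each ring's output
satisfies RingHLF.Rel) on at most θ·2^(n^K·n) input tuples. T → T* proved (node file
`multiRingHard3_of_ringHardOdd`); T* → PolyLoss3 proved (`polyLoss3_of_multiRingHard3`). [deps: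
PolyLoss3, DPLift3] [difficulty: open-problem] -/
@[route_item "route-QuantumAdvantage-SupportDial"]
def MultiRingHard3 : Prop :=
  ∃ K : ℕ, ∃ θ : ℝ, θ < 1 ∧ ∀ c : ℕ, ∃ n₀ : ℕ, ∀ n ≥ n₀, ∀ P : Fin (n ^ K) → Fin n → Literature.Computability.MetaComplexity.Smolensky.CubeFn (ZMod 3) (n ^ K * n), (∀ j i, P j i ∈ Literature.Computability.MetaComplexity.Smolensky.lowDeg (ZMod 3) (n ^ K * n) ((Nat.log 2 n) ^ c)) → ((Finset.univ.filter fun X : Fin (n ^ K) → Fin n → Bool => ∀ j, Literature.Computability.QuantumComplexity.RingHLF.Rel (X j) (fun i => decide (P j i (fun k => X (finProdFinEquiv.symm k).1 (finProdFinEquiv.symm k).2) = 1))).card : ℝ) ≤ θ * (2 : ℝ) ^ (n ^ K * n)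

/-- item stmt-QuantumAdvantage-26123 · support · rank 9 · open · by planner
sources: arXiv:1704.00690, doi:10.1145/28395.28404
[crux] inverse-polynomial single-ring loss at every polylog degree: some k such that for every c,
for all large n, every single-ring 𝔽₃-strategy (z_i = [P_i(x) = 1], deg P_i ≤ (log₂ n)^c) satisfies
the n-cycle relation RingHLF.Rel on at most (1 − n^(−k))·2^n of ALL 2^n inputs (plain count).
Strictly weaker than T (T ⇒ PolyLoss3, `polyLoss3_of_ringHardOdd`) and than AffineCore3's
constant-loss demand; degree-1 slice PROVED (`polyLossOne3`, from the tree's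
AffBells37.affBellsPolyLoss3). [difficulty: L] -/
@[route_item "route-QuantumAdvantage-SupportDial"]
def PolyLoss3 : Prop :=
  ∃ k : ℕ, ∀ c : ℕ, ∃ n₀ : ℕ, ∀ n ≥ n₀, ∀ P : Fin n → Literature.Computability.MetaComplexity.Smolensky.CubeFn (ZMod 3) n, (∀ i, P i ∈ Literature.Computability.MetaComplexity.Smolensky.lowDeg (ZMod 3) n ((Nat.log 2 n) ^ c)) → ((Finset.univ.filter fun x : Fin n → Bool => Literature.Computability.QuantumComplexity.RingHLF.Rel x (fun i => decide (P i x = 1))).card : ℝ) ≤ (1 - 1 / (n : ℝ) ^ k) * (2 : ℝ) ^ n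

/-- item stmt-QuantumAdvantage-26124 · crux · leaf IDEA-NEEDED · rank 7 · open · by planner
why it might fail: no direct-product theorem for polylog-degree 𝔽₃ joint strategies against a search relation is in print (Viola–Wigderson stops at degree ≪ log n and at functions).
sources: doi:10.4086/toc.2008.v004a007, arXiv:1704.00690, goldreich2004
[crux] DECLARED-RESIDUAL (NO-SHRINK piece, critic row 9): the direct-product lift PolyLoss3 →
MultiRingHard3 — an inverse-polynomial loss per ring at every polylog degree amplifies, over n^K
disjoint rings read JOINTLY, to a constant all-rings bound. Proved special cases in the node file:
separable strategies (`dpSeparable3`) and triangular/causal reading orders (`dpTriangular3`,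
induction over rings via `card_winAllSet_triangular_le`); the symmetric cross-reading case is the
open content; constant-degree sub-rung DPLiftConst3 filed as aside. [deps: PolyLoss3] [difficulty:
open-problem] -/
@[route_item "route-QuantumAdvantage-SupportDial", crux (bottleneck := idea) (source := "ledger D-0171 leaf tag IDEA-NEEDED on stmt-QuantumAdvantage-26124, 2026-09-01")]
def DPLift3 : Prop :=
  PolyLoss3 → MultiRingHard3

/-- item stmt-QuantumAdvantage-26531 · support · rank 9 · open · by planner
sources: arXiv:1704.00690, BarringtonStraubingTherien1990
[target] THE JUNCTION X (shared with ProductDial's layer 2; critic grammar 02:48:23Z, ∃C ∀c — the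
STRONG quantifier order ProductDial's direct product needs): ONE exponent C such that at every
polylog output degree (log₂ n)^c, for all large n, every 𝔽₃-polynomial strategy wins at most (1 −
n^(−C))·2^(n−1) of the ODD patterns of the n-cycle ring relation. NECESSARY for T = `RingHardOdd 3`
(C := 1, lens kernels `polyLossOdd3u_of_ringHardOdd` / `polyLossOddU3_of_ringHardOdd`); implies
ProductDial's PolyLoss3 (OddToAll3, k := C+1) and lens-1's PolyLossOdd3 trivially; its degree-1
slice is the tree theorem `AffBells37.affBellsPolyLoss3` ON THE NOSE (lens-5 `oddLossAt_one`);
`ExactnessDial.PolyLossOdd3u ↔ ProductDial.PolyLossOddU3 := Iff.rfl` (critic merged farm check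
02:59:21Z). Here X ⟺ NoPerfectOdd3 ∧ MassStep3u (`node_iff_B`). [deps: NoPerfectOdd3, MassStep3u]
[difficulty: open-problem] LEADER RECORD (2026-08-30; lens-2 g12 «LeaderDial» node 47ef054c, 1154 l,
farm rc0 · 0 sorry · 0 warn · axioms std · bc P1–P8 must-fail FAIL; critic row 57 VERIFIED HIGH,
LAW-node; NO items — caps; residuals recorded): ONE-POLYNOMIAL NORMAL FORM — `symLaw3 :
PolyLossOddU3 ↔ CovPolyLossOddU3` PROVED bo -/
@[route_item "route-QuantumAdvantage-SupportDial", crux]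
def PolyLossOddU3 : Prop :=
  ∃ C : ℕ, ∀ c : ℕ, ∃ n₀ : ℕ, ∀ n ≥ n₀, ∀ P : Fin n → Literature.Computability.MetaComplexity.Smolensky.CubeFn (ZMod 3) n, (∀ i, P i ∈ Literature.Computability.MetaComplexity.Smolensky.lowDeg (ZMod 3) n ((Nat.log 2 n) ^ c)) → ((Finset.univ.filter fun x : Fin n → Bool => Summit.QuantumAdvantage.AdviceFreeQNC0.OddZeros x ∧ Literature.Computability.QuantumComplexity.RingHLF.Rel x (fun i => decide (P i x = 1))).card : ℝ) ≤ (1 - 1 / (n : ℝ) ^ C) * (2 : ℝ) ^ (n - 1)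

/-- item stmt-QuantumAdvantage-26532 · support · rank 9 · open · by planner
sources: arXiv:1704.00690, doi:10.1145/28395.28404
[crux] PIECE 1, the EXACT GRADE of the loss dial at every polylog degree: for every c, for all large
n, no 𝔽₃-polynomial strategy with outputs of degree ≤ (log₂ n)^c (output bits z_i = [P_i(x) = 1])
satisfies the n-cycle ring relation `RingHLF.Rel` on every odd pattern. NECESSARY (lens kernel
`noPerfectOdd3_of_ringHardOdd`) · WEAKER-GENUINE (exact vs constant loss; its δ ≡ 1 slice
`noPerfectAt_one` is a THEOREM while T's δ ≡ 1 slice `RingAffineBellsLt3` is open) · OPEN above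
degree 1, critic-tested NOT a theorem shadow (only the affine cell and the LOCAL cells
`ringLocal_polylog_lt3` / `ringLocalJunta_polylog_lt3` are landed; a PERFECT affine strategy exists
at N = 7, `AffBells23.perfect_seven`, so any proof is genuinely asymptotic) · FLOOR-FREE ·
QUANTUM-CONTENTFUL · ATTACK = IDEA-NEEDED at the two-moduli seam (first lemma
`rel_iff_subcubeParity` proved; transfer target `fullSpan_perfect_iff`; first non-transferring step:
𝔽₃-selectors [P = 1] = 2t + 2t² have no 𝔽₂-character-span description) · INSTRUMENTABLE (finite
𝔽₃-variety per (N, d); census tests: E1 shift-covariant affine N = 8…20 = ladder data n*_cov(1) only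
(finite-N shadow of the theorem `noPerfectAt_one`); E2 covariant a -/
@[route_item "route-QuantumAdvantage-SupportDial"]
def NoPerfectOdd3 : Prop :=
  ∀ c : ℕ, ∃ n₀ : ℕ, ∀ n ≥ n₀, ∀ P : Fin n → Literature.Computability.MetaComplexity.Smolensky.CubeFn (ZMod 3) n, (∀ i, P i ∈ Literature.Computability.MetaComplexity.Smolensky.lowDeg (ZMod 3) n ((Nat.log 2 n) ^ c)) → ∃ x : Fin n → Bool, Summit.QuantumAdvantage.AdviceFreeQNC0.OddZeros x ∧ ¬ Literature.Computability.QuantumComplexity.RingHLF.Rel x (fun i => decide (P i x = 1))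

/-- item stmt-QuantumAdvantage-27381 · crux · leaf IDEA-NEEDED · rank 5 · open · by planner
why it might fail: d₃*(n) may grow only logarithmically (perfect strategies of degree C·log₂ n for infinitely many n), so NoPerfectConst3 holds and T′ fails.
sources: doi:10.1109/SFCS.1993.366874, arXiv:1906.08890, kit:j337947
[crux] PIECE 2, DECLARED RESIDUAL (NO-SHRINK relative to T′ = NoPerfectOdd3: ≡ T′ mod
NoPerfectConst3; T′-grade, itself strictly below T since 26532 is ExactnessDial's open-W binder):
from «d₃* → ∞» to «d₃* super-polylogarithmic» — the growth-RATE content of T′. Vacuously necessary;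
UNDECIDED; no plan claimed (the residual is declared, not hidden). Kill lane: ExactDegreeLogIO3
(aside) ⇒ ¬T′ while NoPerfectConst3 survives. [deps: NoPerfectConst3] [difficulty: open-problem] -/
@[route_item "route-QuantumAdvantage-SupportDial", crux (bottleneck := idea) (experiment := "instrument: kit jobs cited as sources kit:j337947") (source := "ledger D-0171 leaf tag IDEA-NEEDED on stmt-QuantumAdvantage-27381 + ledger wanted_by.sources on stmt-QuantumAdvantage-27381, 2026-09-01")]
def ConstLift3 : Prop :=
  NoPerfectConst3 → NoPerfectOdd3

/-- item stmt-QuantumAdvantage-26533 · crux · leaf IDEA-NEEDED · rank 6 · open · by planner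
why it might fail: a polylog-degree family that is imperfect but loses only an n^(−ω(1)) fraction of the odd class; no mass-transfer mechanism from affine fibres to polylog degree is known.
sources: arXiv:1704.00690, doi:10.4086/toc.2008.v004a007, BarringtonStraubingTherien1990
[crux] PIECE 2′, DECLARED-RESIDUAL(NoPerfectOdd3) of PolyLossOddU3-grade (NOT T-grade; seam
`node_iff_B : PolyLossOddU3 ↔ NoPerfectOdd3 ∧ MassStep3u`): ONE LOSS ⇒ POLYNOMIAL LOSS with one
exponent for all polylog degrees — if no polylog-degree 𝔽₃ strategy is perfect on the odd class,
then some C bounds the odd-class win count of every polylog-degree strategy by (1 − n^(−C))·2^(n−1).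
Vacuous-NECESSARY (`massStep3u_of_ringHardOdd`); at δ ≡ 1 BOTH ends are theorems (`noPerfectAt_one`;
ProductDial `oddLossAt_one` = AffBells37). Mechanism question of record: globalise the cell's
per-fibre dichotomy «exact-or-polynomial-loss ON A FIBRE»
(`ParityModTestDensity.two_pow_le_card_filter_parityMod3_coset`, ROUND-38P2 Thm 38.Z) from affine
fibres to polylog-degree strategies — IDEA-NEEDED; UNDECIDED with census test «minimum odd-class
loss in the E2/E3 classes, N = 8…20: N^(−C) decay vs sub-polynomial vs 0». [deps: NoPerfectOdd3]
[difficulty: open-problem] -/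
@[route_item "route-QuantumAdvantage-SupportDial", crux (bottleneck := idea) (source := "ledger D-0171 leaf tag IDEA-NEEDED on stmt-QuantumAdvantage-26533, 2026-09-01")]
def MassStep3u : Prop :=
  NoPerfectOdd3 → PolyLossOddU3

/-- item stmt-QuantumAdvantage-26534 · support · rank 9 · closed · proved by Summit.QuantumAdvantage.QuantumAdvantage.Theorems.ExactnessDialOddToAll.exactnessDial_oddToAll3 (prover) · by planner
sources: arXiv:1704.00690, BarringtonStraubingTherien1990
[support] the DICTIONARY odd-class ⟹ all-pattern polynomial loss (k := C+1; the even class has ≤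
2^(n−1) patterns, `Summit.QuantumAdvantage.AdviceFreeQNC0.card_even_class_le`, n ≥ 2). PROVED
sorry-free in both lens files (`ExactnessDial.PD.polyLoss3_of_polyLossOdd3u`,
`ProductDial.polyLoss3_of_polyLossOddU3`); consumed by closes; shared with ProductDial's layer 2
(its closes₃ needs the same step). [difficulty: provable-now] PROVED 2026-08-30 in lens-2 g12
«LeaderDial» node 47ef054c (`oddToAll3`: odd ⟹ all dictionary, k := C+1; critic row 57
kernel-confirmed proof-of-item `exactnessDial_oddToAll3 ⊢ Theses.ExactnessDial.OddToAll3`); closes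
on landing of HOME/decomp-qadv-lens-2/g12/tree/ExactnessDialOddToAll.lean (eba11686, stand-alone,
farm rc0 audit ok) --workitem stmt-QuantumAdvantage-26534 (census/prover lane). -/
@[route_item "route-QuantumAdvantage-SupportDial", crux]
def OddToAll3 : Prop :=
  PolyLossOddU3 → PolyLoss3

/-- `OddToAll3` holds: proved by `Summit.QuantumAdvantage.QuantumAdvantage.Theorems.ExactnessDialOddToAll.exactnessDial_oddToAll3`. -/
theorem OddToAll3_holds : OddToAll3 := _root_.Summit.QuantumAdvantage.QuantumAdvantage.Theorems.ExactnessDialOddToAll.exactnessDial_oddToAll3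

/-- item stmt-QuantumAdvantage-28010 · aside · rank 9 · closed · proved by Summit.QuantumAdvantage.QuantumAdvantage.Theorems.StakeDial.sparseColumns_law (prover) · by planner
sources: arXiv:1704.00690, doi:10.1145/28395.28404, doi:10.1007/978-3-642-24508-4, arXiv:1906.08890
[aside · LAW] STAKE DIAL W (lens-1 g9 «StakeDial» rev 6 eff22b10; critic rows 72/72v2/72v3
VERIFIED/CLEARED): BUDGET-SPARSE STRATEGIES ARE NEVER PERFECT — for every d and all n ≥ 3, a
degree-d 𝔽₃-strategy that is silent (never outputs 1) outside a column set M with |M|·(4d+2)+3 ≤ n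
loses on some odd-class input of the n-cycle ring game. PROVED FOR ALL n in the node (`theorem
sparseColumns3` = `sparseColumns3_of_topCharLaw topCharLaw3_all`): product normal form Π_g (1 +
ζ_g·ρ_g) = −S_n in walk coordinates (`prod_eq_neg_canon`; ζ_g degree 4d, stake mask ρ_g degree 2,
silent columns contribute 1), the top-character UNCERTAINTY engine `budget_law` (χ_T kills every
polynomial of degree < |T|, `topChar_eq_zero_of_mem_lowDeg`), and `TopCharLaw3` (∀ n ≥ 2 ∃ T, |T| ≥
n−1, χ_T(S_n) ≠ 0) by the front-peeling transfer operator on 𝔽₃^72 with eventually periodic orbit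
(transient 2, period 24; read-outs topChar_univ_canon / topChar_erase_zero_canon /
topChar_erase_two_canon). TREE: Theorems/StakeDialA (top character, walk degrees, normal form;
p782796), StakeDialB (budget_law, deadStake_law, singleLive_law, tightness adjacentPair_perfect /
no_degreeFree_pair_law = the degree budget is NECESSARY; -/
@[route_item "route-QuantumAdvantage-SupportDial"]
def SparseColumns3 : Prop :=
  ∀ d : ℕ, ∃ n₀ : ℕ, ∀ n ≥ n₀, ∀ P : Fin n → Literature.Computability.MetaComplexity.Smolensky.CubeFn (ZMod 3) n, (∀ i, P i ∈ Literature.Computability.MetaComplexity.Smolensky.lowDeg (ZMod 3) n d) → ∀ M : Finset (Fin n), (∀ g, g ∉ M → ∀ x, P g x ≠ 1) → M.card * (4 * d + 2) + 3 ≤ n → ∃ x : Fin n → Bool, Summit.QuantumAdvantage.AdviceFreeQNC0.OddZeros x ∧ ¬ Literature.Computability.QuantumComplexity.RingHLF.Rel x (fun i => decide (P i x = 1))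

/-- `SparseColumns3` holds: proved by `Summit.QuantumAdvantage.QuantumAdvantage.Theorems.StakeDial.sparseColumns_law`. -/
theorem SparseColumns3_holds : SparseColumns3 := _root_.Summit.QuantumAdvantage.QuantumAdvantage.Theorems.StakeDial.sparseColumns_law

/-- item stmt-QuantumAdvantage-32827 · support · rank 9 · closed · proved by Summit.QuantumAdvantage.QuantumAdvantage.Theorems.SupportDialResidueCertificate.halfDegreeLaw2_of_signTwist (prover) · by planner
sources: decomp-qadv lens-1 g7 ResidueDial.lean d3152e1a, arXiv:1704.00690
[support] BY-NAME GLUE, PROVED IN NODE (LAND-ready): the sign-twist parity law implies the p = 2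
half-degree law — `halfDegreeLaw2_of_signTwist : SignTwistLaw2 → SupportDial.HalfDegreeLaw2` in
lens-1 g7 «ResidueDial» rev 4 (ResidueDial.lean sha256 d3152e1a…, 0 sorry, axioms std; critic row
51v4 VERIFIED HIGH): soundness of the rotation-number certificate
(`smallRingLosesDeg_of_certificate`: summing the ring relations ⟨v, w(β)⟩ = signBit β v over β ∈ Λ,
v ∈ K(β) gives 1 by the sign twist and 0 columnwise by the moment law), the moment law a THEOREM
(`twoBlockLaw2` ⇒ `momentLaw2`), the odd thresholds (2r+3, r) hence every k ≥ 2r+3 by the PROVED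
Y-step `yStepLaw2` (k ↦ k+1) — replaces the binder HalfDegreeLaw2 of `closes` by SignTwistLaw2.
Closer by name: `fun hS => halfDegreeLaw2_of_signTwist hS` (modulo the Iff.rfl junction of the
inlined SignTwistLaw2 text, sk/JunctionSD3.lean rc0). LAND:
Theorems/SupportDialResidueCertificate*.lean (node split into ≤ 400-l modules) --supports 32140.
[deps: SignTwistLaw2, HalfDegreeLaw2] [difficulty: provable-now] PROVED RECORD 2026-08-30T12:26Z:
closer `halfDegreeLaw2_of_signTwist` is in lens-1 g7 rev 5's LAND-READY package
SupportDialResidueCerti -/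
@[route_item "route-QuantumAdvantage-SupportDial", crux]
def SignTwistLift2 : Prop :=
  SignTwistLaw2 → HalfDegreeLaw2

-- `SignTwistLift2` holds: proved by `Summit.QuantumAdvantage.QuantumAdvantage.Theorems.SupportDialResidueCertificate.halfDegreeLaw2_of_signTwist` (its module imports this route file, so no `_holds` link can be stated here).

-- earlier Assembly (stmt-QuantumAdvantage-31931, replaced 2026-08-30T12:01:59Z -> stmt-QuantumAdvantage-32863): retired by None — HalfDegreeLaw2 → HalfToMinority3 → MinorityLift3 → ConstLift3 → MassStep3u → OddToAll3 → DPLift3 → MultiRingBridge3 → Summit.QuantumAdvantage.AdviceFreeQNC0.AdviceFreeQNC0Three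
/-- item stmt-QuantumAdvantage-32863 · assembly · rank 1 · open · by planner
sources: arXiv:1704.00690, doi:10.1145/28395.28404
[assembly] rev 4 (writer g5, 2026-08-30): SignTwistLaw2 → SignTwistLift2 → MinorityLift3 →
ConstLift3 → MassStep3u → OddToAll3 → DPLift3 → AdviceFreeQNC0Three — literally the type of `closes`
rev 4 (0 sorry): the sign-twist parity law S and its PROVED by-name glue give HalfDegreeLaw2
(32140), which at k = n, H := univ gives P1 = NoPerfectMinority3 (31926); the residual MinorityLift3
gives T = NoPerfectConst3 (27380); the shared ExactnessDial/ProductDial chain gives MultiRingHard3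
and the LANDED bridge Theorems.hlfNotFAC0Mod_of_multiRing 3 the leaf F-Q1-p3. Supersedes the rev-0
text (binders HalfDegreeLaw2, HalfToMinority3, MultiRingBridge3 — the latter two dropped in rev 4 of
the file). [difficulty: provable-now] -/
@[route_item "route-QuantumAdvantage-SupportDial"]
def Assembly : Prop :=
  SignTwistLaw2 → SignTwistLift2 → MinorityLift3 → ConstLift3 → MassStep3u → OddToAll3 → DPLift3 → Summit.QuantumAdvantage.AdviceFreeQNC0.AdviceFreeQNC0Three

/-! D-0027 §2.1 — DECIDING THEOREM (planner-authored via `route open/edit --closes-file`; by planner-decomp-qadv-writer-1-g5-0 2026-08-30T11:59:44Z):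
its hypotheses are this route's items and its conclusion the registered leaf `Summit.QuantumAdvantage.AdviceFreeQNC0.AdviceFreeQNC0Three` (rung F-Q1-p3, D-0061) (glue_lint), and it elaborates with this file. -/

/-- Deciding theorem of route SupportDial, rev 4 (writer g5, 2026-08-30; lens-1 g7 node «ResidueDial» rev 4 d3152e1a, critic rows 51–51v4 VERIFIED):
the SIGN-TWIST PARITY LAW `SignTwistLaw2` (crux r3: N_{2r+3} odd for every r ≥ 1) and the by-name glue `SignTwistLift2` (PROVED in the node:
`halfDegreeLaw2_of_signTwist`, moment law + Y-step being theorems) give the p = 2 law `HalfDegreeLaw2` (32140); applied on the whole ring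
(H := univ: an output reading ≤ c·n/(2c+2) inputs is an 𝔽₂-polynomial of degree ≤ c·n/(2c+2) ≤ (n−3)/2, `AffBells22.indicator_mem_lowDeg` +
`Smolensky.lowDeg_mono`, n ≥ 2c+5) it gives PIECE 1 `NoPerfectMinority3`; the declared residual PIECE 2 `MinorityLift3` gives T = `NoPerfectConst3`
(27380); ExactnessDial's declared residuals `ConstLift3` (27381) / `MassStep3u` (26533), the support `OddToAll3` (26534) and ProductDial's `DPLift3`
(26124) give `MultiRingHard3`, and the LANDED bridge `Theorems.hlfNotFAC0Mod_of_multiRing 3` (Theorems/MultiRingBridge.lean) reaches the leaf F-Q1-p3. -/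
@[closes "route-QuantumAdvantage-SupportDial"] theorem closes (hS : SignTwistLaw2) (hL : SignTwistLift2) (h2 : MinorityLift3) (hC : ConstLift3) (hM : MassStep3u)
    (hO : OddToAll3) (hDP : DPLift3) : Summit.QuantumAdvantage.AdviceFreeQNC0.AdviceFreeQNC0Three := by
  classical
  have hD : HalfDegreeLaw2 := hL hS
  have hG : NoPerfectMinority3 := by
    intro c d
    refine ⟨2 * c + 5, fun n hn P _hP hS => ?_⟩
    choose S hS using hS
    have hk : 5 ≤ n := by omega
    have ht : 2 * (c * n / (2 * c + 2)) + 3 ≤ n := by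
      have h1 := Nat.div_mul_le_self (c * n) (2 * c + 2)
      by_contra h
      have h' := not_le.mp h
      nlinarith [h1, hn, h']
    obtain ⟨β, hβ, hrel⟩ := hD n (c * n / (2 * c + 2)) hk ht (fun β j => decide (P j β = 1))
      (fun j => Literature.Computability.MetaComplexity.Smolensky.lowDeg_mono (hS j).1
        (Summit.QuantumAdvantage.AdviceFreeQNC0.AffBells22.indicator_mem_lowDeg (S j) _ (hS j).2))
    exact ⟨β, hβ, hrel⟩
  obtain ⟨K, θ, hθ, hh⟩ := hDP (hO (hM (hC (h2 hG))))
  exact Summit.QuantumAdvantage.AdviceFreeQNC0.adviceFreeQNC0Three_iff.mpr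
    (Summit.QuantumAdvantage.QuantumAdvantage.Theorems.adviceFreeQNC0Sep_of_hlfNotFAC0Mod 3
      (Summit.QuantumAdvantage.QuantumAdvantage.Theorems.hlfNotFAC0Mod_of_multiRing 3 hθ fun c => ⟨K, hh c⟩))

end Summit.QuantumAdvantage.QuantumAdvantage.Theses.SupportDial
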